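import Mathlib
import HarnessLib

/-!
# Crux `DigitPolyUniformity` (stmt-QuantumAdvantage-1392), line `Sketch` (LAR composition, c5 wave:
# Matomäki–Radziwiłł–Tao classes): `vars`-locality of the digit evaluation, two-ends form

Stub S6 (`stub_eval_eq_of_vars_ends`) of line Sketch/LAR of crux stmt-QuantumAdvantage-1392
(`Summit.QuantumAdvantage.QuantumAdvantage.Theses.MobiusLadder.DigitPolyUniformity`). The crux is about
the correlations `Σ_{N<2ⁿ} λ(N)(−1)^{P(bits N)}` for polynomials `P ∈ 𝔽₂[x_0, …, x_{n−1}]` in the binary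
digits `x_i = bit_i(N)`. The cycle-5 wave proves, from Matomäki–Radziwiłł–Tao, the sub-class of all `P`
whose variables lie among the `C` lowest digit positions and the positions `≥ h`; this file is the
locality fact making "`P(bits N)` is a function of `(N mod 2^C, ⌊N/2^h⌋)`" precise:

  if every `i ∈ vars P` has `i < C` or `h ≤ i`, and `N ≡ N' (mod 2^C)`, `⌊N/2^h⌋ = ⌊N'/2^h⌋`,
  then `P(bits N) = P(bits N')`.

Proof: `MvPolynomial.eval₂Hom_congr'` reduces to `bit_i(N) = bit_i(N')` for `i ∈ vars P`. For `i < C`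
the bit is a bit of `N mod 2^C` (`Nat.testBit_mod_two_pow`); for `h ≤ i` it is bit `i − h` of `⌊N/2^h⌋`
(`Nat.testBit_div_two_pow`). Mathlib only; no named facts.
-/

namespace Summit.QuantumAdvantage.DigitPolyUniformity.SketchLAR

namespace EvalEnds

/-- A digit below `C` is a digit of the residue mod `2^C`: if `i < C` and `N ≡ N' (mod 2^C)` then
`bit_i(N) = bit_i(N')`. [folklore] -/
theorem testBit_eq_of_mod_two_pow_eq {C N N' i : ℕ} (hi : i < C) (hlow : N % 2 ^ C = N' % 2 ^ C) :
    Nat.testBit N i = Nat.testBit N' i := by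
  have h1 : Nat.testBit (N % 2 ^ C) i = Nat.testBit N i := by
    rw [Nat.testBit_mod_two_pow, decide_eq_true hi, Bool.true_and]
  have h2 : Nat.testBit (N' % 2 ^ C) i = Nat.testBit N' i := by
    rw [Nat.testBit_mod_two_pow, decide_eq_true hi, Bool.true_and]
  rw [← h1, ← h2, hlow]

/-- A digit at position `≥ h` is a digit of the quotient by `2^h`: if `h ≤ i` and
`⌊N/2^h⌋ = ⌊N'/2^h⌋` then `bit_i(N) = bit_i(N')` (it is bit `i − h` of the quotient). [folklore] -/
theorem testBit_eq_of_div_two_pow_eq {h N N' i : ℕ} (hi : h ≤ i) (hhigh : N / 2 ^ h = N' / 2 ^ h) :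
    Nat.testBit N i = Nat.testBit N' i := by
  have h1 : Nat.testBit (N / 2 ^ h) (i - h) = Nat.testBit N i := by
    rw [Nat.testBit_div_two_pow, Nat.sub_add_cancel hi]
  have h2 : Nat.testBit (N' / 2 ^ h) (i - h) = Nat.testBit N' i := by
    rw [Nat.testBit_div_two_pow, Nat.sub_add_cancel hi]
  rw [← h1, ← h2, hhigh]

end EvalEnds

/-- **`vars`-locality of the digit evaluation, two-ends form.** If every variable of `P` is one of
`x_0, …, x_{C−1}` or `x_h, x_{h+1}, …`, then `P(bits N)` depends only on `(N mod 2^C, ⌊N/2^h⌋)`: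
`N ≡ N' (mod 2^C)` and `⌊N/2^h⌋ = ⌊N'/2^h⌋` force `P(bits N) = P(bits N')`. [folklore] -/
theorem stub_eval_eq_of_vars_ends {n : ℕ} (P : MvPolynomial (Fin n) (ZMod 2)) (C h : ℕ)
    (hP : ∀ i ∈ P.vars, (i : ℕ) < C ∨ h ≤ (i : ℕ)) {N N' : ℕ}
    (hlow : N % 2 ^ C = N' % 2 ^ C) (hhigh : N / 2 ^ h = N' / 2 ^ h) :
    MvPolynomial.eval (fun i : Fin n => if Nat.testBit N i then (1 : ZMod 2) else 0) P =
      MvPolynomial.eval (fun i : Fin n => if Nat.testBit N' i then (1 : ZMod 2) else 0) P := by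
  refine MvPolynomial.eval₂Hom_congr' rfl (fun i hi _ => ?_) rfl
  have hbit : Nat.testBit N i = Nat.testBit N' i := by
    rcases hP i hi with hC | hh
    · exact EvalEnds.testBit_eq_of_mod_two_pow_eq hC hlow
    · exact EvalEnds.testBit_eq_of_div_two_pow_eq hh hhigh
  simp only [hbit]

end Summit.QuantumAdvantage.DigitPolyUniformity.SketchLAR
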